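import Literature.Computability.Complexity.NegationElimination
import HarnessLib

/-!
# Route NegLimited — door support `AMCoverMonPairs` (line `correlation-door`, stub 1; rung F-N1/p3, ROUND-8 §B.1)

Registered stub `stub_amCoverMonPairs` of the skeleton `correlation-door` on the door item
`NegLimited.NeglimitedEpsLogNegationsR` (stmt-PneNP-19860; HOME/pnp-ideate-p3/r9/Skeleton-R9-door.lean,
finer plan `turnkey-R8/door/Skeleton-AMCover.lean`): the **Amano–Maruoka / Rossman cover** of the monotone
jumps of a De Morgan circuit with few negations.  A circuit `C` over `{∧₂, ∨₂, ¬}` with `≤ t` NOT gates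
yields a list of `≤ 2^(t+1) − 1` Boolean functions, each constant or computed by a `{∧₂, ∨₂}`-circuit with
no more gates than `C`, such that every monotone jump of `C` (`x ≤ y`, `C x = 0`, `C y = 1`) is a jump
(`g x = 0`, `g y = 1`) of some member (Amano–Maruoka 2005, Thm 3.2; Rossman, CCC 2015, Lemma 3.2,
"for all monotone pairs").

Proof = plain circuit surgery on the tree's PROVED kit `NegationElimination.lean` (the same freeze step
as `GateList.negationElimination_step`, but keeping BOTH constants): induct on the NOT budget
(`coverAux`); at the FIRST NOT gate (input wire `w` after the NOT-free prefix `pre`) the function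
`g₀ x = wireOf x (vals pre x) w` is monotone (prefix over `{∧₂, ∨₂, 0, 1}`:
`const_or_exists_monotone_circuit` + `Circuit.monotone_eval_of_isOver_monotoneBasis`), so a jump
`(x, y)` of the program has `(g₀ x, g₀ y) ∈ {(0,1)} ∪ {(ε,ε)}`; in the first case `g₀` covers it, in
the second the program with the NOT gate FROZEN to the constant `¬ε` (`vals_replace_eq`, `WF.replace`)
has the same wires on `x, y` and one NOT gate fewer (`coverStep`, cover `g₀ :: (L_true ++ L_false)`,
count `1 + 2(2^(t+1) − 1) = 2^(t+2) − 1`); the circuit-level packaging is `coverPack`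
(`circuit_eval`, `const_or_exists_monotone_circuit`).  The budget induction `coverAux` is the
planner's `coverAux_of_step` (Skeleton-AMCover.lean) with the step discharged.
-/

set_option linter.dupNamespace false -- `Summit.PneNP.PneNP.…`: summit = sub-problem name (D-0017 single-conjunct layout)

namespace Summit.PneNP.PneNP.Theorems.NegLimitedDoor

open Finset
open Literature.Computability.Complexity
open Literature.Computability.Complexity.GateList

/-- The item statement `AMCoverMonPairs` (verbatim: turnkey-R8/add_items_door_v2.json and the registered
skeleton `correlation-door`): the Amano–Maruoka / Rossman cover of the monotone jumps of a circuit with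
`≤ t` NOT gates by `≤ 2^(t+1) − 1` monotone (or constant) functions of no larger circuit size. -/
def AMCoverMonPairs : Prop :=
  ∀ (ι : Type) [Fintype ι] [DecidableEq ι] (C : Literature.Computability.Complexity.Circuit ι) (t : ℕ), C.IsOver Literature.Computability.Complexity.deMorganBasis → C.negationCount ≤ t → ∃ gs : List ((ι → Bool) → Bool), gs.length ≤ 2 ^ (t + 1) - 1 ∧ (∀ g ∈ gs, ((∃ b : Bool, ∀ x, g x = b) ∨ ∃ M : Literature.Computability.Complexity.Circuit ι, M.IsOver Literature.Computability.Complexity.monotoneBasis ∧ M.size ≤ C.size ∧ M.Computes g)) ∧ ∀ x y : ι → Bool, x ≤ y → C.eval x = false → C.eval y = true → ∃ g ∈ gs, g x = false ∧ g y = true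

/-! ### Straight-line covers -/

/-- A member of a cover of the program `gs`: carried by the output wire `o'` of a NOT-free program `ms`
over `{∧₂, ∨₂, 0, 1}` that is no longer than `gs` (planner's `IsMember`, Skeleton-AMCover.lean). -/
def IsMember {ι : Type} (gs : List (Gate ι)) (g : (ι → Bool) → Bool) : Prop :=
  ∃ (ms : List (Gate ι)) (o' : ι ⊕ ℕ), WF ms ∧ (∀ g' ∈ ms, g'.fn ∈ monotoneBasis01) ∧
    ms.length ≤ gs.length ∧ OutOK ms.length o' ∧ ∀ x, g x = wireOf x (vals ms x) o'

/-- Membership only depends on the length of the ambient program. -/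
theorem IsMember.of_length_le {ι : Type} {gs gs' : List (Gate ι)} {g : (ι → Bool) → Bool}
    (h : IsMember gs g) (hlen : gs.length ≤ gs'.length) : IsMember gs' g := by
  obtain ⟨ms, o', h1, h2, h3, h4, h5⟩ := h
  exact ⟨ms, o', h1, h2, h3.trans hlen, h4, h5⟩

/-- Straight-line cover statement at NOT budget `t` (the induction hypothesis; planner's `CoverAux`). -/
def CoverAux (ι : Type) (t : ℕ) : Prop :=
  ∀ (gs : List (Gate ι)) (o : ι ⊕ ℕ), WF gs → (∀ g ∈ gs, g.fn ∈ deMorganBasis01) →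
    OutOK gs.length o → negs gs ≤ t →
      ∃ L : List ((ι → Bool) → Bool), L.length ≤ 2 ^ (t + 1) - 1 ∧ (∀ g ∈ L, IsMember gs g) ∧
        ∀ x y : ι → Bool, x ≤ y → wireOf x (vals gs x) o = false → wireOf y (vals gs y) o = true →
          ∃ g ∈ L, g x = false ∧ g y = true

/-- The argument of the first NOT gate is a MONOTONE function of the input: the NOT-free prefix is a
program over `{∧₂, ∨₂, 0, 1}`, whose output wires are constant or computed over `{∧₂, ∨₂}`
(`const_or_exists_monotone_circuit`), hence monotone (`Circuit.monotone_eval_of_isOver_monotoneBasis`). -/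
theorem monotone_wireOf_prefix {ι : Type} (pre : List (Gate ι)) (w : ι ⊕ ℕ) (hwf : WF pre)
    (hB : ∀ g ∈ pre, g.fn ∈ monotoneBasis01) (hw : OutOK pre.length w) :
    Monotone fun x => wireOf x (vals pre x) w := by
  rcases const_or_exists_monotone_circuit pre w hwf hB hw with ⟨b, hb⟩ | ⟨C, hC, -, hev⟩
  · intro x y _
    simp only [hb x, hb y, le_refl]
  · intro x y hxy
    simp only [← hev x, ← hev y]
    exact C.monotone_eval_of_isOver_monotoneBasis hC hxy

/-- **The freeze step, keeping both constants** (Amano–Maruoka 2005 §3 / Rossman CCC'15 Lemma 3.2;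
tree template `GateList.negationElimination_step`): given covers at budget `t`, a program whose first NOT
gate is `notGate w` after the NOT-free prefix `pre`, with `≤ t + 1` NOT gates, is covered by
`g₀ :: (L_true ++ L_false)`, where `g₀ x = wireOf x (vals pre x) w` and `L_ε` covers the program with
the NOT gate frozen to the constant `¬ε` (same wires on `{g₀ = ε}`, one NOT gate fewer). -/
theorem coverStep (ι : Type) (t : ℕ) (ih : CoverAux ι t)
    (pre post : List (Gate ι)) (w o : ι ⊕ ℕ)
    (hwf : WF (pre ++ notGate w :: post)) (hB : ∀ g ∈ pre ++ notGate w :: post, g.fn ∈ deMorganBasis01)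
    (ho : OutOK (pre ++ notGate w :: post).length o) (hnegs : negs (pre ++ notGate w :: post) ≤ t + 1)
    (hpre : ∀ g ∈ pre, g.fn ≠ GateFn.not) :
    ∃ L : List ((ι → Bool) → Bool), L.length ≤ 2 ^ (t + 2) - 1 ∧
      (∀ g ∈ L, IsMember (pre ++ notGate w :: post) g) ∧
      ∀ x y : ι → Bool, x ≤ y →
        wireOf x (vals (pre ++ notGate w :: post) x) o = false →
        wireOf y (vals (pre ++ notGate w :: post) y) o = true →
          ∃ g ∈ L, g x = false ∧ g y = true := by
  -- the monotone function read by the first NOT gate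
  set g₀ : (ι → Bool) → Bool := fun x => wireOf x (vals pre x) w with hg₀
  have hwfpre : WF pre := hwf.of_append_left
  have hBpre : ∀ g ∈ pre, g.fn ∈ monotoneBasis01 := fun g hg =>
    mem_monotoneBasis01_of_ne_not (hB g (by simp [hg])) (hpre g hg)
  have hw : OutOK pre.length w := fun m hm => hwf.gateOK_mid (0 : Fin 1) m hm
  have hmono : Monotone g₀ := monotone_wireOf_prefix pre w hwfpre hBpre hw
  have hmem₀ : IsMember (pre ++ notGate w :: post) g₀ :=
    ⟨pre, w, hwfpre, hBpre, by simp, hw, fun _ => rfl⟩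
  -- the program with the NOT gate frozen to `¬ε`, and its cover from the induction hypothesis
  have hfreeze : ∀ ε : Bool, ∃ L : List ((ι → Bool) → Bool), L.length ≤ 2 ^ (t + 1) - 1 ∧
      (∀ g ∈ L, IsMember (pre ++ notGate w :: post) g) ∧
      ∀ x y : ι → Bool, x ≤ y → g₀ x = ε → g₀ y = ε →
        wireOf x (vals (pre ++ notGate w :: post) x) o = false →
        wireOf y (vals (pre ++ notGate w :: post) y) o = true →
          ∃ g ∈ L, g x = false ∧ g y = true := by
    intro ε
    set gs' := pre ++ constGate ι (!ε) :: post with hgs'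
    have hwf' : WF gs' := hwf.replace (gateOK_constGate _ _)
    have hB' : ∀ g ∈ gs', g.fn ∈ deMorganBasis01 := by
      intro g hg
      simp only [hgs', List.mem_append, List.mem_cons] at hg
      rcases hg with hg | rfl | hg
      · exact hB g (by simp [hg])
      · simpa using const_mem_deMorganBasis01 (!ε)
      · exact hB g (by simp [hg])
    have hlen : gs'.length = (pre ++ notGate w :: post).length := by simp [hgs']
    have hnegs' : negs gs' ≤ t := by
      have h1 : negs (pre ++ notGate w :: post) = negs pre + (1 + negs post) := by simp
      have h2 : negs gs' = negs pre + (0 + negs post) := by simp [hgs']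
      omega
    -- on inputs where the argument of the NOT gate is `ε`, nothing changes
    have hvals : ∀ x, g₀ x = ε → vals gs' x = vals (pre ++ notGate w :: post) x := by
      intro x hx
      refine (vals_replace_eq pre post _ _ x ?_).symm
      show (!(wireOf x (vals pre x) w)) = !ε
      rw [← hx]
    obtain ⟨L, h1, h2, h3⟩ := ih gs' o hwf' hB' (hlen ▸ ho) hnegs'
    refine ⟨L, h1, fun g hg => (h2 g hg).of_length_le hlen.le, ?_⟩
    intro x y hxy hx hy hox hoy
    exact h3 x y hxy (by rw [hvals x hx]; exact hox) (by rw [hvals y hy]; exact hoy)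
  obtain ⟨LT, hT1, hT2, hT3⟩ := hfreeze true
  obtain ⟨LF, hF1, hF2, hF3⟩ := hfreeze false
  refine ⟨g₀ :: (LT ++ LF), ?_, ?_, ?_⟩
  · -- `1 + (2^(t+1) - 1) + (2^(t+1) - 1) = 2^(t+2) - 1`
    have h2 : 1 ≤ 2 ^ (t + 1) := Nat.one_le_two_pow
    have h4 : 2 ^ (t + 2) = 2 * 2 ^ (t + 1) := by rw [pow_succ]; ring
    simp only [List.length_cons, List.length_append]
    omega
  · intro g hg
    simp only [List.mem_cons, List.mem_append] at hg
    rcases hg with rfl | hg | hg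
    · exact hmem₀
    · exact hT2 g hg
    · exact hF2 g hg
  · intro x y hxy hox hoy
    have hle : g₀ x ≤ g₀ y := hmono hxy
    cases hx : g₀ x <;> cases hy : g₀ y
    · -- both `false`: the frozen program (ε = false) covers
      obtain ⟨g, hg, hgx, hgy⟩ := hF3 x y hxy hx hy hox hoy
      exact ⟨g, by simp [hg], hgx, hgy⟩
    · -- `g₀` itself jumps
      exact ⟨g₀, by simp, hx, hy⟩
    · -- impossible by monotonicity
      rw [hx, hy] at hle
      exact absurd hle (by decide)
    · -- both `true`: the frozen program (ε = true) covers
      obtain ⟨g, hg, hgx, hgy⟩ := hT3 x y hxy hx hy hox hoy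
      exact ⟨g, by simp [hg], hgx, hgy⟩

/-- **The induction on the NOT budget** (planner's `coverAux_of_step`, with the step discharged by
`coverStep`): budget `0` is covered by the program itself; at budget `t + 1` either the program already
has `≤ t` NOT gates, or it has a first NOT gate (`exists_first_notGate`) and `coverStep` applies. -/
theorem coverAux (ι : Type) : ∀ t : ℕ, CoverAux ι t := by
  intro t
  induction t with
  | zero =>
    intro gs o hwf hB ho hnegs
    have hnegs0 : negs gs = 0 := Nat.le_zero.1 hnegs
    refine ⟨[fun x => wireOf x (vals gs x) o], by simp, ?_, ?_⟩
    · intro g hg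
      simp only [List.mem_singleton] at hg
      subst hg
      refine ⟨gs, o, hwf, fun g' hg' => ?_, le_rfl, ho, fun x => rfl⟩
      refine mem_monotoneBasis01_of_ne_not (hB g' hg') fun hnot => ?_
      obtain ⟨pre, post, rfl⟩ := List.append_of_mem hg'
      have : negs (pre ++ g' :: post) = negs pre + (1 + negs post) := by simp [hnot]
      omega
    · intro x y _ hx hy
      exact ⟨fun x => wireOf x (vals gs x) o, by simp, hx, hy⟩
  | succ t ih =>
    intro gs o hwf hB ho hnegs
    by_cases hle : negs gs ≤ t
    · obtain ⟨L, h1, h2, h3⟩ := ih gs o hwf hB ho hle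
      refine ⟨L, h1.trans ?_, h2, h3⟩
      have : 2 ^ (t + 1) ≤ 2 ^ (t + 2) := Nat.pow_le_pow_right (by norm_num) (by omega)
      omega
    · obtain ⟨pre, w, post, rfl, hpre⟩ := exists_first_notGate (gs := gs) (by omega)
      exact coverStep ι t ih pre post w o hwf hB ho hnegs hpre

/-- **Packaging** (planner's `stub_coverPack`): from the straight-line cover of `C.gates` to the
circuit-level statement — `circuit_eval`, `wf_gates`, `Circuit.wf_output`, `circuit_negationCount`,
`deMorganBasis_subset_deMorganBasis01`, and per member `const_or_exists_monotone_circuit` (constant, or a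
`{∧₂, ∨₂}`-circuit of size `≤ ms.length ≤ C.size`). -/
theorem coverPack (ι : Type) [Fintype ι] [DecidableEq ι] (C : Circuit ι) (t : ℕ)
    (hC : C.IsOver deMorganBasis) (ht : C.negationCount ≤ t) (hcov : CoverAux ι t) :
    ∃ gs : List ((ι → Bool) → Bool), gs.length ≤ 2 ^ (t + 1) - 1 ∧
      (∀ g ∈ gs, ((∃ b : Bool, ∀ x, g x = b) ∨
        ∃ M : Circuit ι, M.IsOver monotoneBasis ∧ M.size ≤ C.size ∧ M.Computes g)) ∧
      ∀ x y : ι → Bool, x ≤ y → C.eval x = false → C.eval y = true →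
        ∃ g ∈ gs, g x = false ∧ g y = true := by
  obtain ⟨L, h1, h2, h3⟩ := hcov C.gates C.output (wf_gates C)
    (fun g hg => deMorganBasis_subset_deMorganBasis01 (hC g hg)) C.wf_output
    (by rw [← circuit_negationCount]; exact ht)
  refine ⟨L, h1, fun g hg => ?_, fun x y hxy hx hy => ?_⟩
  · obtain ⟨ms, o', hwf, hms, hlen, ho', hg'⟩ := h2 g hg
    rcases const_or_exists_monotone_circuit ms o' hwf hms ho' with ⟨b, hb⟩ | ⟨M, hM, hsize, hev⟩
    · exact Or.inl ⟨b, fun x => by rw [hg' x, hb x]⟩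
    · exact Or.inr ⟨M, hM, hsize.trans hlen, fun x => by rw [hev x, hg' x]⟩
  · exact h3 x y hxy (by rw [← circuit_eval]; exact hx) (by rw [← circuit_eval]; exact hy)

/-- **Stub 1 of line `correlation-door` PROVED** (`AMCoverMonPairs`, by name): the Amano–Maruoka / Rossman
cover of the monotone jumps of a De Morgan circuit with `≤ t` NOT gates by `≤ 2^(t+1) − 1` constant-or-
monotone functions of no larger monotone circuit size (Amano–Maruoka 2005 Thm 3.2; Rossman CCC 2015
Lemma 3.2). -/
theorem stub_amCoverMonPairs : AMCoverMonPairs := by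
  intro ι _ _ C t hC ht
  exact coverPack ι C t hC ht (coverAux ι t)

/-- The same fact under its descriptive name. -/
theorem amCoverMonPairs_holds : AMCoverMonPairs := stub_amCoverMonPairs

end Summit.PneNP.PneNP.Theorems.NegLimitedDoor
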